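import Summits.ValiantsHypothesis.ValiantsHypothesis.Theorems.LacunarySymmetroidMatrixDescartesCensusDoorA34RootRank

/-!
# `MatrixDescartes` census — DOOR A at `(3,4)`: the BLOCK ANATOMY of the null-top stratum (`det S₃ = 0`)

HONEST FRAMING.  Object-search cell `pub-symmetroid`, door-A seat `val-sym-door-p3` (g10); beside the OPEN typed statement
`DoorA34 = PosRootLawAt 3 4 18` (route item `Theses.LacunarySymmetroid.DoorA34`, stmt-ValiantsHypothesis-19980), asserted nowhere.
On the NULL-TOP STRATUM (top letter singular) the determinant of a `(3,4)` pencil splits into three BLOCKS (any real letters, any exponents):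

* `det_pencil_eq_blocks` — for every pencil, `det (∑ₗ X^(d l) • S l) = det G + X^(d 3)·tr(adj G · S₃) + X^(2 d 3)·tr(adj S₃ · G) + X^(3 d 3)·C(det S₃)`
  with the CORE `G = ∑_{l<3} X^(d l) • S l` (the tree's ring-generic `det_add_smul_fin_three'` applied in `ℝ[X]`);
* `det_pencil_nullTop_eq_blocks` — if `det S₃ = 0`: `det = D + X^(d 3)·A + X^(2 d 3)·T` with `D = det G` (the `(3,3)` core nine-row; `10` monomials),
  `A = tr(adj G · S₃)` (the level-1 compression; `6` monomials), `T = tr(adj S₃ · G)` (the level-2 compression; `3` monomials — for `adj S₃ = τ·kkᵀ`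
  it is `τ·kᵀ G k`, `eval_trace_vecMulVec_mul`).

WHY THE CELL RECORDS IT (seat report HOME/DOOR-A34-P3G10-REPORT.md §2b(iv)): this is the exact skeleton of the FLAG on the stratum.  The kernel object
…CensusDoorA34NullTopSeventeen (the census eighteen (0,1,4,359) compressed exactly onto `det S₃ = 0`) has `17` roots decomposing EXACTLY as
`9 (D, signvar 9) + 1 + 4 (A, signvar 4, all beyond the nine) + 1 + 2 (T, signvar 2)`; a stratum chain-`18` — which the tree's null-top lift turns
into a nineteen — needs `signvar A = 5` with all five roots beyond the nine: the cell's `(5,2)` flag.  Nothing here bounds anything; `DoorA34` stays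
OPEN; nothing bears on `MatrixDescartes` (stmt-ValiantsHypothesis-18050) or `VP ≠ VNP`.  [folklore] `3 × 3` determinant expansion; elementary.
-/

-- `Summit.ValiantsHypothesis.ValiantsHypothesis.…` repeats a component by the D-0017 layout
-- (single-conjunct summit), which the `dupNamespace` linter flags; the name is mandated.
set_option linter.dupNamespace false

namespace Summit.ValiantsHypothesis.ValiantsHypothesis.Theorems.LacunarySymmetroidMatrixDescartes.Census

open Polynomial Finset
open scoped BigOperators Polynomial Matrix

/-- Splitting the `(3,4)` pencil into its CORE (first three letters) and the top term. [folklore] -/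
theorem pencil_eq_core_add_top (d : Fin 4 → ℕ) (S : Fin 4 → Matrix (Fin 3) (Fin 3) ℝ) :
    (∑ l, (X : ℝ[X]) ^ d l • (S l).map C) =
      (∑ l : Fin 3, (X : ℝ[X]) ^ d (Fin.castSucc l) • (S (Fin.castSucc l)).map C) + (X : ℝ[X]) ^ d 3 • (S 3).map C := by
  rw [Fin.sum_univ_castSucc]
  rfl

/-- **Block expansion of the `(3,4)` determinant along the top letter** (all pencils):
`det = det G + X^(d 3)·tr(adj G · S₃) + X^(2 d 3)·tr(adj S₃ · G) + X^(3 d 3)·det S₃`, `G` the core. [folklore] -/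
theorem det_pencil_eq_blocks (d : Fin 4 → ℕ) (S : Fin 4 → Matrix (Fin 3) (Fin 3) ℝ) :
    (∑ l, (X : ℝ[X]) ^ d l • (S l).map C).det =
      (∑ l : Fin 3, (X : ℝ[X]) ^ d (Fin.castSucc l) • (S (Fin.castSucc l)).map C).det
      + (X : ℝ[X]) ^ d 3 * ((∑ l : Fin 3, (X : ℝ[X]) ^ d (Fin.castSucc l) • (S (Fin.castSucc l)).map C).adjugate * (S 3).map C).trace
      + ((X : ℝ[X]) ^ d 3) ^ 2 * (((S 3).map C).adjugate * (∑ l : Fin 3, (X : ℝ[X]) ^ d (Fin.castSucc l) • (S (Fin.castSucc l)).map C)).trace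
      + ((X : ℝ[X]) ^ d 3) ^ 3 * C ((S 3).det) := by
  rw [pencil_eq_core_add_top, det_add_smul_fin_three']
  congr 1
  rw [← RingHom.mapMatrix_apply, ← RingHom.map_det]

/-- **Block anatomy on the NULL-TOP STRATUM.**  If the top letter is singular, the cube block vanishes:
`det = D + X^(d 3)·A + X^(2 d 3)·T` with `D = det G`, `A = tr(adj G · S₃)`, `T = tr(adj S₃ · G)`. [folklore] -/
theorem det_pencil_nullTop_eq_blocks (d : Fin 4 → ℕ) (S : Fin 4 → Matrix (Fin 3) (Fin 3) ℝ) (h3 : (S 3).det = 0) :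
    (∑ l, (X : ℝ[X]) ^ d l • (S l).map C).det =
      (∑ l : Fin 3, (X : ℝ[X]) ^ d (Fin.castSucc l) • (S (Fin.castSucc l)).map C).det
      + (X : ℝ[X]) ^ d 3 * ((∑ l : Fin 3, (X : ℝ[X]) ^ d (Fin.castSucc l) • (S (Fin.castSucc l)).map C).adjugate * (S 3).map C).trace
      + ((X : ℝ[X]) ^ d 3) ^ 2 * (((S 3).map C).adjugate * (∑ l : Fin 3, (X : ℝ[X]) ^ d (Fin.castSucc l) • (S (Fin.castSucc l)).map C)).trace := by
  rw [det_pencil_eq_blocks, h3, map_zero, mul_zero, add_zero]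

/-- The level-2 block for a RANK-ONE ADJUGATE: if `adj S₃ = τ • k kᵀ` then `tr(adj S₃ · M) = τ · kᵀ M k` for every matrix `M` over `ℝ[X]`
(so on the rank-two part of the stratum the top block is `τ·kᵀ G k`, a `3`-nomial). [folklore] -/
theorem trace_adjugate_mul_of_eq_smul_vecMulVec (S₃ : Matrix (Fin 3) (Fin 3) ℝ) (τ : ℝ) (k : Fin 3 → ℝ)
    (hadj : S₃.adjugate = τ • Matrix.vecMulVec k k) (M : Matrix (Fin 3) (Fin 3) ℝ[X]) :
    ((S₃.map C).adjugate * M).trace = C τ * ∑ i, ∑ j, C (k i) * C (k j) * M j i := by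
  have hmap : (S₃.map C).adjugate = (S₃.adjugate).map C := by
    rw [← RingHom.mapMatrix_apply, ← RingHom.map_adjugate, RingHom.mapMatrix_apply]
  rw [hmap, hadj]
  simp only [Matrix.trace, Matrix.diag, Matrix.mul_apply, Matrix.map_apply, Matrix.smul_apply, Matrix.vecMulVec_apply,
    smul_eq_mul, map_mul, Finset.mul_sum]
  refine Finset.sum_congr rfl fun i _ => Finset.sum_congr rfl fun j _ => ?_
  ring

end Summit.ValiantsHypothesis.ValiantsHypothesis.Theorems.LacunarySymmetroidMatrixDescartes.Census
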